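import Mathlib

/-! # Stub `stub_dissocRecordCard` — crux `TwoProducts` (stmt-ValiantsHypothesis-5906), line `corner-log-linearization`

Rung piece R2 (lead c3): records are independent, hence few.

In the lifted moment normal form one has `N` atoms `c i : letters → ℂ` (letters = exponent vectors in
`Fin 2 →₀ ℕ`, the letter finset `U`) and integer letter weights `W`.  A letter `a ∈ U` is a (greedy) RECORD if its
column `fun i => c i a : Fin N → ℂ` is NOT in the `ℂ`-span of the all-ones vector together with the columns of the
other letters `b ∈ U`, `b ≠ a`, of weight `W b ≤ W a`.  Enumerating any finite set of records by increasing weight,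
each new column avoids the span of the all-ones vector and the earlier columns (`Submodule.span_mono`), so the
all-ones vector followed by the record columns is a linearly independent family (`LinearIndependent.finCons`,
induction on the maximal-weight record via `Finset.induction_on_max_value`); its length `#records + 1` is at most
`finrank ℂ (Fin N → ℂ) = N`.  For `N = 0` every column is `0`, so there are no records.  Hence
`#records ≤ N - 1`. [folklore] -/

set_option linter.dupNamespace false

namespace Summit.ValiantsHypothesis.ValiantsHypothesis.Theorems.TwoProducts.DissocRecordCard

open scoped BigOperators

variable {K V ι : Type*} [DivisionRing K] [AddCommGroup V] [Module K V]

/-- Independence of records: if every `a ∈ T` is a record (its column `col a` avoids the span of `one` and the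
columns of the other letters of `U` of weight `≤ W a`), then there is a linearly independent family of
`T.card + 1` vectors inside `insert one (col '' T)` (namely `one` followed by the columns of `T` in increasing
weight).  Requires `one ≠ 0`. [folklore] -/
theorem exists_linearIndependent_of_records (col : ι → V) {one : V} (hone : one ≠ 0) (U : Finset ι)
    (W : ι → ℤ) (T : Finset ι) :
    (∀ a ∈ T, a ∈ U ∧ col a ∉ Submodule.span K
      (insert one (col '' {b | b ∈ U ∧ b ≠ a ∧ W b ≤ W a}))) →
    ∃ f : Fin (T.card + 1) → V, LinearIndependent K f ∧ Set.range f ⊆ insert one (col '' ↑T) := by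
  classical
  induction T using Finset.induction_on_max_value W with
  | empty =>
    intro _
    rw [Finset.card_empty, Nat.zero_add]
    refine ⟨fun _ => one, linearIndependent_unique_iff.2 hone, ?_⟩
    rintro _ ⟨_, rfl⟩
    exact Set.mem_insert _ _
  | insert a s has hmax ih =>
    intro hT
    obtain ⟨f, hf, hrange⟩ := ih fun b hb => hT b (Finset.mem_insert_of_mem hb)
    obtain ⟨-, ha⟩ := hT a (Finset.mem_insert_self a s)
    have hsub : insert one (col '' (↑s : Set ι)) ⊆
        insert one (col '' {b | b ∈ U ∧ b ≠ a ∧ W b ≤ W a}) := by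
      refine Set.insert_subset_insert (Set.image_mono ?_)
      intro b hb
      exact ⟨(hT b (Finset.mem_insert_of_mem hb)).1, fun h => has (h ▸ hb), hmax b hb⟩
    have hnot : col a ∉ Submodule.span K (Set.range f) := fun h =>
      ha (Submodule.span_mono (hrange.trans hsub) h)
    rw [Finset.card_insert_of_notMem has]
    refine ⟨Fin.cons (col a) f, hf.finCons hnot, ?_⟩
    rw [Fin.range_cons, Finset.coe_insert, Set.image_insert_eq, Set.insert_comm]
    exact Set.insert_subset_insert hrange

/-- Record count: with `one ≠ 0` in a finite-dimensional space `V`, the set of records of `U` (letters whose column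
avoids the span of `one` and the columns of the other letters of weight `≤` their own) has `ncard + 1 ≤ finrank K V`.
[folklore] -/
theorem ncard_records_succ_le_finrank [Module.Finite K V] (col : ι → V) {one : V} (hone : one ≠ 0)
    (U : Finset ι) (W : ι → ℤ) :
    {a : ι | a ∈ U ∧ col a ∉ Submodule.span K
      (insert one (col '' {b | b ∈ U ∧ b ≠ a ∧ W b ≤ W a}))}.ncard + 1 ≤ Module.finrank K V := by
  have hfin : {a : ι | a ∈ U ∧ col a ∉ Submodule.span K
      (insert one (col '' {b | b ∈ U ∧ b ≠ a ∧ W b ≤ W a}))}.Finite :=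
    U.finite_toSet.subset fun a ha => ha.1
  obtain ⟨f, hf, -⟩ := exists_linearIndependent_of_records (K := K) col hone U W hfin.toFinset
    fun a ha => hfin.mem_toFinset.1 ha
  have hcard := hf.fintype_card_le_finrank
  rw [Fintype.card_fin] at hcard
  rwa [Set.ncard_eq_toFinset_card _ hfin]

/-- Stub `stub_dissocRecordCard` (rung piece R2 of line `corner-log-linearization`): among the letters `a ∈ U` of
`N` atoms `c i`, those whose column `fun i => c i a` is not in the `ℂ`-span of the all-ones vector and the columns
of the other letters of weight `W b ≤ W a` (the records) number at most `N - 1`. [folklore] -/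
theorem stub_dissocRecordCard : ∀ (N : ℕ) (c : Fin N → (Fin 2 →₀ ℕ) → ℂ) (U : Finset (Fin 2 →₀ ℕ))
    (W : (Fin 2 →₀ ℕ) → ℤ),
    {a : Fin 2 →₀ ℕ | a ∈ U ∧ (fun i => c i a) ∉ Submodule.span ℂ
      (insert (fun _ : Fin N => (1 : ℂ)) ((fun b : Fin 2 →₀ ℕ => fun i : Fin N => c i b) ''
        {b : Fin 2 →₀ ℕ | b ∈ U ∧ b ≠ a ∧ W b ≤ W a}))}.ncard ≤ N - 1 := by
  intro N c U W
  rcases Nat.eq_zero_or_pos N with rfl | hN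
  · -- no coordinates: every column is `0`, so there are no records
    have hempty : {a : Fin 2 →₀ ℕ | a ∈ U ∧ (fun i => c i a) ∉ Submodule.span ℂ
        (insert (fun _ : Fin 0 => (1 : ℂ)) ((fun b : Fin 2 →₀ ℕ => fun i : Fin 0 => c i b) ''
          {b : Fin 2 →₀ ℕ | b ∈ U ∧ b ≠ a ∧ W b ≤ W a}))} = ∅ := by
      ext a
      simp only [Set.mem_setOf_eq, Set.mem_empty_iff_false, iff_false, not_and, not_not]
      intro _
      rw [Subsingleton.elim (fun i : Fin 0 => c i a) 0]
      exact Submodule.zero_mem _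
    rw [hempty, Set.ncard_empty]
  · have hone : (fun _ : Fin N => (1 : ℂ)) ≠ 0 := fun h => one_ne_zero (congr_fun h ⟨0, hN⟩)
    have h := ncard_records_succ_le_finrank (K := ℂ) (fun (b : Fin 2 →₀ ℕ) (i : Fin N) => c i b) hone U W
    rw [Module.finrank_fin_fun] at h
    exact Nat.le_sub_one_of_lt h

end Summit.ValiantsHypothesis.ValiantsHypothesis.Theorems.TwoProducts.DissocRecordCard
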